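import Summits.CriticalPhenomena.PercolationContinuityZ3.Theorems.Transplant.StatementHeisenbergGRRFrmNode
import Summits.CriticalPhenomena.PercolationContinuityZ3.Theorems.Transplant.SkelFrm1HoldsAllL
import HarnessLib

/-!
# TARGET 4-C2(H-GRR) CLOSED BY NAME: `heisenbergGRRCriticalContinuity_holds : HeisenbergGRRCriticalContinuity`
# — θ(p_c) = 0 on the point-symmetry-free Cayley graph `Cay(H₃(ℤ); {a, b, ab, ba²}^{±1})` of the Heisenberg group

One application of the single-type frames-only node `samePDropOfSkeletonFrm₁_holds` (N2, `SkelFrm1HoldsAllL`, p3 lineage) through the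
stmt link `heisenbergGRRCriticalContinuity_of_frmNode₁` (`StatementHeisenbergGRRFrmNode`, p396173) over p1-g15's sheared one-type
`PlanarSkeletonFrm` on `HeisGRR.X` (`HeisenbergGRRFrm`).
builds on p205010 (kernel theorem, internal audit signed; external expert review pending).
Status sentence (coordinator 2026-08-20T04:30Z): "θ(p_c) = 0 on ℤ^d, all d ≥ 2 — kernel-verified (Lean 4/Mathlib, standard axioms); internal
adversarial audit SIGNED 2026-08-20 04:29Z; external expert review pending."
Lane `prim-bschramm-*`, seat `prim-bschramm-stmt` (gen 25; text staged by gen 23); helper file (`--supports stmt-CriticalPhenomena-4575 --as helper`).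
[cite: BenjaminiSchramm1996, Conj. 4 (p. 75) and §2] [cite: HermonHutchcroft2021, §1 Conj. 1.1]
-/

namespace Summit.CriticalPhenomena.PercolationContinuityZ3.Theorems.Transplant

open Literature.Probability.Percolation Literature.Probability.LatticeModels

/-- **TARGET 4-C2(H-GRR) HOLDS**: `θ_X((0,0,0), p_c(X)) = 0` for `X = Cay(H₃(ℤ); {a, b, ab, ba²}^{±1})` — the first Cayley graph with trivial point symmetry
(`Aut X = H₃(ℤ)`), from the single-type frames-only node `samePDropOfSkeletonFrm₁_holds` through `heisenbergGRRCriticalContinuity_of_frmNode₁`.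
builds on p205010 (kernel theorem, internal audit signed; external expert review pending). [cite: BenjaminiSchramm1996, Conj. 4 (p. 75)] -/
theorem heisenbergGRRCriticalContinuity_holds : HeisenbergGRRCriticalContinuity :=
  heisenbergGRRCriticalContinuity_of_frmNode₁ samePDropOfSkeletonFrm₁_holds

/-- Every-vertex form. builds on p205010 (kernel theorem, internal audit signed; external expert review pending). [cite: BenjaminiSchramm1996, Conj. 4 (p. 75)] -/
theorem heisenbergGRRCriticalContinuity_all_holds (v : ℤ × ℤ × ℤ) : theta HeisGRR.X v (criticalProbIOf HeisGRR.X v) = 0 :=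
  heisenbergGRRCriticalContinuity_all_of_frmNode₁ samePDropOfSkeletonFrm₁_holds v

end Summit.CriticalPhenomena.PercolationContinuityZ3.Theorems.Transplant
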